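import Mathlib
import Summits.QuantumFields.YangMills.Theorems.F4SubCurvatureDoorHexagonNormalFormDefs

/-!
# Hexagon normal form — the typed lemma (O2) `RealRootedO2` is FALSE as stated (degenerate `G ≡ 0`); repaired form

Support note for crux `stmt-QuantumFields-23125` (`F4SubCurvatureDoor.RationalToGeneral`), crux idea «hexagon-normal-form» of
planner ym-idea-3 (HOME l15/HexagonSketch.lean; tree definitions `Theorems/F4SubCurvatureDoorHexagonNormalFormDefs.lean`, p660858).

The typed statement `RealRootedO2` («every zero of `G` is real») quantifies over ALL real-entire pairs `(F, G)` with the hexagon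
Wick condition — including `G ≡ 0`, for which `WickHexagon F 0` only constrains the zeros of `F` and the conclusion
`∀ z, G z = 0 → z.im = 0` fails at `z = i`.  Witness: `F ≡ 1`, `G ≡ 0` (no zeros of `F + P_s·G = 1` at all).

* `not_realRootedO2 : ¬ RealRootedO2` — the misstatement, by the witness above;
* the REPAIR is to exclude the identically vanishing `G` (the intended reading of the card, whose proof sketch «Hurwitz as
  `s → ∞`, `Φ_s/(−32 s³) → G` locally uniformly» presupposes `G ≢ 0`): `∀ F G, IsRealEntire F → IsRealEntire G → (∃ z, G z ≠ 0) →
  WickHexagon F G → ∀ z, G z = 0 → z.im = 0`.  That repaired statement needs Hurwitz's theorem (size L, owner ruling 19:30Z «leave it»)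
  and is NOT proved here.

CLASS: refuted-misstated (degenerate case), not substantive.  Mathlib + the Defs file; THEOREMS ONLY; no `sorry`.  Nothing about the
cruxes 23125/23035, the route or the Yang–Mills mass gap is affected or proved.  Free-hands width seat `ym-line-sfw-p2-w4` g18,
`--supports stmt-QuantumFields-23125`.
-/

set_option autoImplicit false

namespace Summit.QuantumFields.YangMills.Cruxes.RationalToGeneral.HexagonNormalForm

open scoped ComplexConjugate

/-- The constant function `1` is real entire. [folklore] -/
theorem isRealEntire_one : IsRealEntire (fun _ : ℂ => (1 : ℂ)) :=
  ⟨differentiable_const _, fun _ => by simp⟩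

/-- The zero function is real entire. [folklore] -/
theorem isRealEntire_zero : IsRealEntire (fun _ : ℂ => (0 : ℂ)) :=
  ⟨differentiable_const _, fun _ => by simp⟩

/-- `(F, G) = (1, 0)` satisfies the hexagon Wick condition vacuously (`F + P_s G = 1` has no zeros). [folklore] -/
theorem wickHexagon_one_zero : WickHexagon (fun _ : ℂ => (1 : ℂ)) (fun _ : ℂ => (0 : ℂ)) := by
  intro s _ z hz
  simp at hz

/-- **`RealRootedO2` is false as typed**: the degenerate pair `F ≡ 1`, `G ≡ 0` satisfies every hypothesis, while `G(i) = 0` with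
`Im i = 1 ≠ 0`.  Repair: add the hypothesis `∃ z, G z ≠ 0` (then it is Hurwitz's theorem, not proved here). [folklore] -/
theorem not_realRootedO2 : ¬ RealRootedO2 := by
  intro h
  have := h (fun _ => (1 : ℂ)) (fun _ => (0 : ℂ)) isRealEntire_one isRealEntire_zero wickHexagon_one_zero Complex.I rfl
  simp at this

end Summit.QuantumFields.YangMills.Cruxes.RationalToGeneral.HexagonNormalForm
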